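import Literature.AlgebraicGeometry.Frobenioids.ModelFrobenioidOrder
import HarnessLib

/-!
# Frobenioids I, Theorem 5.2 (ii), first sentence: the model Frobenioid is a Frobenioid of
# isotropic type (abc-iut cell, layer L1, node F-D1a)

Mochizuki, *The geometry of Frobenioids I: the general theory*, Kyushu J. Math. **62** (2008)
293–400, §5, Theorem 5.2 (ii), kurims text p. 101 [cite: MochizukiFrdI2008, Thm. 5.2(ii) p.101]:

> "(ii) The category `C` is a Frobenioid [with respect to the functor `C → F_Φ`] of isotropic
> and model — hence, in particular, birationally Frobenius-normalized — type."

Here: clauses (iv)–(vii) of Def. 1.3 for `C → F_Φ` (`C = ModelFrobenioid Φ B DivB`, Thm. 5.2 (i))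
and the conclusion `ModelFrobenioid.isFrobenioid` — `C` is a Frobenioid — together with
`isOfIsotropicType` ("of isotropic type"), under exactly the printed hypotheses: `Φ` a divisorial
monoid on `D`, `B` a group-like monoid on `D`, `Div_B : B → Φ^gp`, `D` connected and totally
epimorphic (Def. 1.1 (iv)). Parts 1–3: `ModelFrobenioidPreFrobenioid.lean`,
`ModelFrobenioidPullbacks.lean`, `ModelFrobenioidDivision.lean`, `ModelFrobenioidOrder.lean`.
Deliberately NOT here: "of model type" (waits for Def. 4.5 (i) / Prop. 4.4, typed by the §3–4 files)
and the base-Frobenius pair of the zero section (Def. 2.7 vocabulary, `BaseFrobeniusSections.lean`);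
the Frobenius-triviality of the objects `(A_D, 0)` is `isFrobeniusTrivial_zeroObj`. The second
sentence of (ii) (`O^×` on `C^birat` vs `B`) and (iii), (iv) are separate nodes.
No statement of the paper is strengthened.
-/

noncomputable section

namespace Literature.AlgebraicGeometry.Frobenioids

namespace ModelFrobenioid

open CategoryTheory Opposite

universe w v u

variable {D : Type u} [Category.{v} D] {Φ B : Dᵒᵖ ⥤ CommMonCat.{w}} {DivB : B ⟶ monoidGp Φ}

section Clauses

variable {A Bo X Y X' Y' : ModelFrobenioid Φ B DivB}

/-! ### Definition 1.3 (iv) -/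

/-- Def. 1.3 (iv)(a), existence: `(n, f, x, u) = (1, f, 0, 0) ∘ (1, id, x, u) ∘ (n, id, 0, 0)` through
`(A_D, n·α)` and `(A_D, f^*β)`. [cite: MochizukiFrdI2008, Thm. 5.2(ii) p.101] -/
theorem iv_a_exists (hΦd : Objectwise (fun M _ => IsDivisorial M) Φ)
    (hBg : Objectwise (fun M _ => IsGroupLike M) B) (φ : A ⟶ Bo) :
    ∃ (X Y : ModelFrobenioid Φ B DivB) (γ : A ⟶ X) (β : X ⟶ Y) (α : Y ⟶ Bo),
      γ ≫ β ≫ α = φ ∧ PreFrobenioid.IsFrobeniusType (toElem Φ B DivB) γ ∧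
        PreFrobenioid.IsPreStep (toElem Φ B DivB) β ∧ PreFrobenioid.IsPullbackMorphism (toElem Φ B DivB) α := by
  let f : A.base ⟶ Bo.base := baseMap φ
  let x : Φ.obj (op A.base) := div φ
  let u : B.obj (op A.base) := unit φ
  let X : ModelFrobenioid Φ B DivB := ⟨A.base, A.cls ^ (degFr φ : ℕ)⟩
  let Y : ModelFrobenioid Φ B DivB := ⟨A.base, pullGp Φ f Bo.cls⟩
  let γ : A ⟶ X := mkHom A X (degFr φ) (𝟙 _) 1 1 (by
    show A.cls ^ (degFr φ : ℕ) * Algebra.GrothendieckGroup.of 1 =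
      pullGp Φ (𝟙 A.base) (A.cls ^ (degFr φ : ℕ)) * divB Φ B DivB _ 1
    rw [map_one, mul_one, pullGp_id, map_one, mul_one])
  let β : X ⟶ Y := mkHom X Y 1 (𝟙 _) x u (by
    show (A.cls ^ (degFr φ : ℕ)) ^ ((1 : ℕ+) : ℕ) * Algebra.GrothendieckGroup.of x =
      pullGp Φ (𝟙 A.base) (pullGp Φ f Bo.cls) * divB Φ B DivB _ u
    rw [PNat.one_coe, pow_one, pullGp_id]
    exact rel φ)
  let α : Y ⟶ Bo := mkHom Y Bo 1 f 1 1 (by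
    show pullGp Φ f Bo.cls ^ ((1 : ℕ+) : ℕ) * Algebra.GrothendieckGroup.of 1 =
      pullGp Φ f Bo.cls * divB Φ B DivB _ 1
    rw [PNat.one_coe, pow_one, map_one, mul_one, map_one, mul_one])
  refine ⟨X, Y, γ, β, α, hom_ext ?_ ?_ ?_ ?_, ⟨⟨isCoAngular hBg _, rfl⟩,
    show IsIso (𝟙 A.base) from inferInstance⟩, ⟨rfl, show IsIso (𝟙 A.base) from inferInstance⟩,
    isPullbackMorphism_of hΦd hBg rfl rfl⟩
  · show (1 * 1) * degFr φ = degFr φ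
    rw [one_mul, one_mul]
  · show 𝟙 A.base ≫ 𝟙 A.base ≫ f = baseMap φ
    rw [Category.id_comp, Category.id_comp]
  · show pull Φ (𝟙 A.base) (pull Φ (𝟙 A.base) 1 * div φ ^ ((1 : ℕ+) : ℕ)) *
        (1 : Φ.obj (op A.base)) ^ (((1 : ℕ+) * 1 : ℕ+) : ℕ) = div φ
    simp only [pull_id, map_one, one_mul, mul_one, PNat.one_coe, pow_one]
  · show pull B (𝟙 A.base) (pull B (𝟙 A.base) 1 * unit φ ^ ((1 : ℕ+) : ℕ)) *
        (1 : B.obj (op A.base)) ^ (((1 : ℕ+) * 1 : ℕ+) : ℕ) = unit φ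
    simp only [pull_id, map_one, one_mul, mul_one, PNat.one_coe, pow_one]

/-- Def. 1.3 (iv)(a), uniqueness up to `(α ∘ δ, δ⁻¹ ∘ β ∘ ε, ε⁻¹ ∘ γ)`: `ε = γ' / γ`,
`δ = (β' ∘ ε) / β`, and `α = α' ∘ δ` by cancelling the epimorphism `β ∘ γ`.
[cite: MochizukiFrdI2008, Thm. 5.2(ii) p.101] -/
theorem iv_a_unique (hΦ : IsMonoidOn Φ) (hΦd : Objectwise (fun M _ => IsDivisorial M) Φ)
    (hB : IsMonoidOn B) (hBg : Objectwise (fun M _ => IsGroupLike M) B) (hDe : IsTotallyEpimorphic D)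
    (φ : A ⟶ Bo) (γ : A ⟶ X) (β : X ⟶ Y) (α : Y ⟶ Bo) (γ' : A ⟶ X') (β' : X' ⟶ Y') (α' : Y' ⟶ Bo)
    (h : γ ≫ β ≫ α = φ) (hγ : PreFrobenioid.IsFrobeniusType (toElem Φ B DivB) γ)
    (hβ : PreFrobenioid.IsPreStep (toElem Φ B DivB) β) (hα : PreFrobenioid.IsPullbackMorphism (toElem Φ B DivB) α)
    (h' : γ' ≫ β' ≫ α' = φ) (hγ' : PreFrobenioid.IsFrobeniusType (toElem Φ B DivB) γ')
    (hβ' : PreFrobenioid.IsPreStep (toElem Φ B DivB) β')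
    (hα' : PreFrobenioid.IsPullbackMorphism (toElem Φ B DivB) α') :
    ∃ (ε : X ≅ X') (δ : Y ≅ Y'), γ ≫ ε.hom = γ' ∧ β ≫ δ.hom = ε.hom ≫ β' ∧ α = δ.hom ≫ α' := by
  haveI : IsIso (baseMap γ) := hγ.2
  haveI : IsIso (baseMap γ') := hγ'.2
  haveI : IsIso (baseMap β) := hβ.2
  haveI : IsIso (baseMap β') := hβ'.2
  have hγd : div γ = 1 := hγ.1.2
  have hγd' : div γ' = 1 := hγ'.1.2
  obtain ⟨hα1, hαd⟩ := degFr_div_of_isPullbackMorphism hΦd hα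
  obtain ⟨hα1', hαd'⟩ := degFr_div_of_isPullbackMorphism hΦd hα'
  have hβ1 : degFr β = 1 := hβ.1
  have hβ1' : degFr β' = 1 := hβ'.1
  -- components of `h`, `h'`
  have en : (degFr α * degFr β) * degFr γ = degFr φ := congrArg Hom.degFr h
  have en' : (degFr α' * degFr β') * degFr γ' = degFr φ := congrArg Hom.degFr h'
  rw [hβ1, hα1, mul_one, one_mul] at en
  rw [hβ1', hα1', mul_one, one_mul] at en'
  have hn : degFr γ = degFr γ' := en.trans en'.symm
  have ed : pull Φ (baseMap γ) (pull Φ (baseMap β) (div α) * div β ^ (degFr α : ℕ)) *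
      div γ ^ ((degFr α * degFr β : ℕ+) : ℕ) = div φ := congrArg Hom.div h
  have ed' : pull Φ (baseMap γ') (pull Φ (baseMap β') (div α') * div β' ^ (degFr α' : ℕ)) *
      div γ' ^ ((degFr α' * degFr β' : ℕ+) : ℕ) = div φ := congrArg Hom.div h'
  rw [hβ1, hα1, hαd, hγd, mul_one, PNat.one_coe, pow_one, one_pow, map_one, one_mul, mul_one] at ed
  rw [hβ1', hα1', hαd', hγd', mul_one, PNat.one_coe, pow_one, one_pow, map_one, one_mul, mul_one] at ed'
  -- ed : pull (Base γ) (div β) = div φ, ed' : pull (Base γ') (div β') = div φ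
  obtain ⟨uγ, huγ⟩ := (hBg A.base).isUnit (unit γ)
  obtain ⟨uβ, huβ⟩ := (hBg X.base).isUnit (unit β)
  -- `ε = γ' / γ`
  have e₁ : degFr γ' = 1 * degFr γ := by rw [one_mul, hn]
  have e₂ : baseMap γ' = baseMap γ ≫ inv (baseMap γ) ≫ baseMap γ' := by rw [IsIso.hom_inv_id_assoc]
  have e₃ : div γ' = pull Φ (baseMap γ) 1 * div γ ^ ((1 : ℕ+) : ℕ) := by
    rw [map_one, one_mul, PNat.one_coe, pow_one, hγd, hγd']
  have e₄ : unit γ' = pull B (baseMap γ) (pull B (inv (baseMap γ)) (unit γ' * ↑uγ⁻¹)) *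
      unit γ ^ ((1 : ℕ+) : ℕ) := by
    rw [← pull_comp, IsIso.hom_inv_id, pull_id, PNat.one_coe, pow_one, ← huγ, Units.inv_mul_cancel_right]
  let ε : X ⟶ X' := divRight γ γ' 1 (inv (baseMap γ) ≫ baseMap γ') 1
    (pull B (inv (baseMap γ)) (unit γ' * ↑uγ⁻¹)) e₁ e₂ e₃ e₄
  have hγε : γ ≫ ε = γ' := comp_divRight γ γ' _ _ _ _ e₁ e₂ e₃ e₄
  haveI : IsIso (baseMap ε) := (inferInstance : IsIso (inv (baseMap γ) ≫ baseMap γ'))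
  haveI : IsIso ε := isIso_of hBg ε rfl rfl
  -- the zero divisors of `β`, `β'` match along `Base ε`
  have hdiv : div β = pull Φ (baseMap ε) (div β') := by
    apply (hΦ.isCharInjective (baseMap γ)).1
    show pull Φ (baseMap γ) (div β) = pull Φ (baseMap γ) (pull Φ (inv (baseMap γ) ≫ baseMap γ') (div β'))
    rw [← pull_comp, IsIso.hom_inv_id_assoc, ed, ed']
  -- `δ = (β' ∘ ε) / β`
  let d : Y.base ⟶ Y'.base := inv (baseMap β) ≫ baseMap ε ≫ baseMap β'
  have f₁ : degFr (ε ≫ β') = 1 * degFr β := by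
    show degFr β' * 1 = 1 * degFr β
    rw [hβ1, hβ1']
  have f₂ : baseMap (ε ≫ β') = baseMap β ≫ d := by
    show baseMap ε ≫ baseMap β' = baseMap β ≫ inv (baseMap β) ≫ baseMap ε ≫ baseMap β'
    rw [IsIso.hom_inv_id_assoc]
  have f₃ : div (ε ≫ β') = pull Φ (baseMap β) 1 * div β ^ ((1 : ℕ+) : ℕ) := by
    show pull Φ (baseMap ε) (div β') * (1 : Φ.obj (op X.base)) ^ (degFr β' : ℕ) = pull Φ (baseMap β) 1 * div β ^ ((1 : ℕ+) : ℕ)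
    rw [one_pow, mul_one, map_one, one_mul, PNat.one_coe, pow_one, hdiv]
  have f₄ : unit (ε ≫ β') = pull B (baseMap β)
      (pull B (inv (baseMap β)) (unit (ε ≫ β') * ↑uβ⁻¹)) * unit β ^ ((1 : ℕ+) : ℕ) := by
    rw [← pull_comp, IsIso.hom_inv_id, pull_id, PNat.one_coe, pow_one, ← huβ, Units.inv_mul_cancel_right]
  let δ : Y ⟶ Y' := divRight β (ε ≫ β') 1 d 1
    (pull B (inv (baseMap β)) (unit (ε ≫ β') * ↑uβ⁻¹)) f₁ f₂ f₃ f₄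
  have hβδ : β ≫ δ = ε ≫ β' := comp_divRight β (ε ≫ β') _ _ _ _ f₁ f₂ f₃ f₄
  haveI : IsIso d := (inferInstance : IsIso (inv (baseMap β) ≫ baseMap ε ≫ baseMap β'))
  haveI : IsIso (baseMap δ) := (inferInstance : IsIso d)
  haveI : IsIso δ := isIso_of hBg δ rfl rfl
  -- `α = α' ∘ δ` by cancelling the epimorphism `β ∘ γ`
  haveI := (isTotallyEpimorphic (DivB := DivB) hΦ hΦd hB hBg hDe).epi (γ ≫ β)
  have hαδ : α = δ ≫ α' := by
    apply (cancel_epi (γ ≫ β)).mp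
    rw [Category.assoc, h, Category.assoc, reassoc_of% hβδ, reassoc_of% hγε, h']
  exact ⟨asIso ε, asIso δ, hγε, hβδ, hαδ⟩

/-- Def. 1.3 (iv)(b): pull-back morphisms are LB-invertible and linear. [cite: MochizukiFrdI2008, Thm. 5.2(ii) p.101] -/
theorem iv_b (hΦd : Objectwise (fun M _ => IsDivisorial M) Φ)
    (hBg : Objectwise (fun M _ => IsGroupLike M) B) (φ : A ⟶ Bo)
    (h : PreFrobenioid.IsPullbackMorphism (toElem Φ B DivB) φ) :
    PreFrobenioid.IsLBInvertible (toElem Φ B DivB) φ ∧ PreFrobenioid.IsLinear (toElem Φ B DivB) φ := by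
  obtain ⟨h₁, h₂⟩ := degFr_div_of_isPullbackMorphism hΦd h
  exact ⟨⟨isCoAngular hBg φ, h₂⟩, h₁⟩

/-! ### Definition 1.3 (v) -/

/-- Def. 1.3 (v)(a): pre-steps are monomorphisms (cancellation in `Φ(X_D)`, `B(X_D)`, and
`Base(φ)` invertible). [cite: MochizukiFrdI2008, Thm. 5.2(ii) p.101] -/
theorem v_a (hΦd : Objectwise (fun M _ => IsDivisorial M) Φ)
    (hBg : Objectwise (fun M _ => IsGroupLike M) B) (φ : A ⟶ Bo)
    (h : PreFrobenioid.IsPreStep (toElem Φ B DivB) φ) : Mono φ := by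
  haveI : IsIso (baseMap φ) := h.2
  have h1 : degFr φ = 1 := h.1
  refine ⟨fun {X} g g' e => ?_⟩
  haveI : IsCancelMul (Φ.obj (op X.base)) :=
    isIntegral_iff_isCancelMul.mp (hΦd X.base).isPreDivisorial.isIntegral
  haveI : IsCancelMul (B.obj (op X.base)) :=
    isIntegral_iff_isCancelMul.mp (hBg X.base).isPreDivisorial.isIntegral
  have eb : baseMap g ≫ baseMap φ = baseMap g' ≫ baseMap φ := congrArg Hom.base e
  have ed : pull Φ (baseMap g) (div φ) * div g ^ (degFr φ : ℕ) =
      pull Φ (baseMap g') (div φ) * div g' ^ (degFr φ : ℕ) := congrArg Hom.div e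
  have eu : pull B (baseMap g) (unit φ) * unit g ^ (degFr φ : ℕ) =
      pull B (baseMap g') (unit φ) * unit g' ^ (degFr φ : ℕ) := congrArg Hom.unit e
  have en : degFr φ * degFr g = degFr φ * degFr g' := congrArg Hom.degFr e
  have eb' : baseMap g = baseMap g' := (cancel_mono (baseMap φ)).mp eb
  rw [eb', h1, PNat.one_coe, pow_one, pow_one] at ed eu
  rw [h1, one_mul, one_mul] at en
  exact hom_ext en eb' (mul_left_cancel ed) (mul_left_cancel eu)

/-- Def. 1.3 (v)(b), existence: `φ = id ∘ φ`. [cite: MochizukiFrdI2008, Thm. 5.2(ii) p.101] -/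
theorem v_b_exists (hBg : Objectwise (fun M _ => IsGroupLike M) B) (φ : A ⟶ Bo)
    (h : PreFrobenioid.IsPreStep (toElem Φ B DivB) φ) :
    ∃ (X : ModelFrobenioid Φ B DivB) (β : A ⟶ X) (α : X ⟶ Bo), β ≫ α = φ ∧
      PreFrobenioid.IsCoAngularPreStep (toElem Φ B DivB) β ∧
        (PreFrobenioid.IsIsometry (toElem Φ B DivB) α ∧ PreFrobenioid.IsPreStep (toElem Φ B DivB) α) :=
  ⟨Bo, φ, 𝟙 Bo, Category.comp_id φ, ⟨isCoAngular hBg φ, h⟩, isIsometry_id Bo, isPreStep_id Bo⟩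

/-- Def. 1.3 (v)(b), uniqueness (isometric pre-steps are isomorphisms). [cite: MochizukiFrdI2008, Thm. 5.2(ii) p.101] -/
theorem v_b_unique (hBg : Objectwise (fun M _ => IsGroupLike M) B) (φ : A ⟶ Bo) (β : A ⟶ X) (α : X ⟶ Bo)
    (β' : A ⟶ X') (α' : X' ⟶ Bo) (e : β ≫ α = φ)
    (_hβ : PreFrobenioid.IsCoAngularPreStep (toElem Φ B DivB) β)
    (hα : PreFrobenioid.IsIsometry (toElem Φ B DivB) α ∧ PreFrobenioid.IsPreStep (toElem Φ B DivB) α)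
    (e' : β' ≫ α' = φ) (_hβ' : PreFrobenioid.IsCoAngularPreStep (toElem Φ B DivB) β')
    (hα' : PreFrobenioid.IsIsometry (toElem Φ B DivB) α' ∧ PreFrobenioid.IsPreStep (toElem Φ B DivB) α') :
    ∃ γ : X ≅ X', β ≫ γ.hom = β' ∧ α = γ.hom ≫ α' := by
  haveI := isIso_of_isIsometry_of_isPreStep hBg hα.1 hα.2
  haveI := isIso_of_isIsometry_of_isPreStep hBg hα'.1 hα'.2
  refine ⟨asIso α ≪≫ (asIso α').symm, ?_, ?_⟩
  · show β ≫ α ≫ inv α' = β'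
    rw [← Category.assoc, e, ← e', Category.assoc, IsIso.hom_inv_id, Category.comp_id]
  · show α = (α ≫ inv α') ≫ α'
    rw [Category.assoc, IsIso.inv_hom_id, Category.comp_id]

/-- Def. 1.3 (v)(c), existence: `φ = φ ∘ id`. [cite: MochizukiFrdI2008, Thm. 5.2(ii) p.101] -/
theorem v_c_exists (hBg : Objectwise (fun M _ => IsGroupLike M) B) (φ : A ⟶ Bo)
    (h : PreFrobenioid.IsPreStep (toElem Φ B DivB) φ) :
    ∃ (X : ModelFrobenioid Φ B DivB) (β' : A ⟶ X) (α' : X ⟶ Bo), β' ≫ α' = φ ∧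
      (PreFrobenioid.IsIsometry (toElem Φ B DivB) β' ∧ PreFrobenioid.IsPreStep (toElem Φ B DivB) β') ∧
        PreFrobenioid.IsCoAngularPreStep (toElem Φ B DivB) α' :=
  ⟨A, 𝟙 A, φ, Category.id_comp φ, ⟨isIsometry_id A, isPreStep_id A⟩, isCoAngular hBg φ, h⟩

/-- Def. 1.3 (v)(c), uniqueness. [cite: MochizukiFrdI2008, Thm. 5.2(ii) p.101] -/
theorem v_c_unique (hBg : Objectwise (fun M _ => IsGroupLike M) B) (φ : A ⟶ Bo) (β : A ⟶ X) (α : X ⟶ Bo)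
    (β' : A ⟶ X') (α' : X' ⟶ Bo) (e : β ≫ α = φ)
    (hβ : PreFrobenioid.IsIsometry (toElem Φ B DivB) β ∧ PreFrobenioid.IsPreStep (toElem Φ B DivB) β)
    (_hα : PreFrobenioid.IsCoAngularPreStep (toElem Φ B DivB) α) (e' : β' ≫ α' = φ)
    (hβ' : PreFrobenioid.IsIsometry (toElem Φ B DivB) β' ∧ PreFrobenioid.IsPreStep (toElem Φ B DivB) β')
    (_hα' : PreFrobenioid.IsCoAngularPreStep (toElem Φ B DivB) α') :
    ∃ γ : X ≅ X', β ≫ γ.hom = β' ∧ α = γ.hom ≫ α' := by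
  haveI := isIso_of_isIsometry_of_isPreStep hBg hβ.1 hβ.2
  haveI := isIso_of_isIsometry_of_isPreStep hBg hβ'.1 hβ'.2
  refine ⟨(asIso β).symm ≪≫ asIso β', ?_, ?_⟩
  · show β ≫ inv β ≫ β' = β'
    rw [IsIso.hom_inv_id_assoc]
  · show α = (inv β ≫ β') ≫ α'
    rw [Category.assoc, e', ← e, IsIso.inv_hom_id_assoc]

/-! ### Definition 1.3 (vi), (vii) -/

/-- Def. 1.3 (vi): base-equivalent, metrically equivalent co-angular pre-steps `φ`, `ψ : A → B`
differ by the unit `φ / ψ = (1, id, 0, Base(ψ)⁻¹^*(u_φ − u_ψ))` of `B`.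
[cite: MochizukiFrdI2008, Thm. 5.2(ii) p.101] -/
theorem vi (hBg : Objectwise (fun M _ => IsGroupLike M) B) (φ ψ : A ⟶ Bo)
    (hφ : PreFrobenioid.IsCoAngularPreStep (toElem Φ B DivB) φ)
    (hψ : PreFrobenioid.IsCoAngularPreStep (toElem Φ B DivB) ψ)
    (hb : PreFrobenioid.BaseEquivalent (toElem Φ B DivB) φ ψ)
    (hm : PreFrobenioid.MetricallyEquivalent (toElem Φ B DivB) φ ψ) :
    ∃ α ∈ PreFrobenioid.unitsSubgroup (toElem Φ B DivB) Bo, ψ ≫ α.hom = φ := by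
  haveI : IsIso (baseMap ψ) := hψ.2.2
  have hb' : baseMap φ = baseMap ψ := hb
  have hm' : div φ = div ψ := hm
  have hφ1 : degFr φ = 1 := hφ.2.1
  have hψ1 : degFr ψ = 1 := hψ.2.1
  obtain ⟨uu, huu⟩ := (hBg A.base).isUnit (unit ψ)
  have e₁ : degFr φ = 1 * degFr ψ := by rw [hφ1, hψ1, mul_one]
  have e₂ : baseMap φ = baseMap ψ ≫ 𝟙 Bo.base := by rw [Category.comp_id, hb']
  have e₃ : div φ = pull Φ (baseMap ψ) 1 * div ψ ^ ((1 : ℕ+) : ℕ) := by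
    rw [map_one, one_mul, PNat.one_coe, pow_one, hm']
  have e₄ : unit φ = pull B (baseMap ψ) (pull B (inv (baseMap ψ)) (unit φ * ↑uu⁻¹)) *
      unit ψ ^ ((1 : ℕ+) : ℕ) := by
    rw [← pull_comp, IsIso.hom_inv_id, pull_id, PNat.one_coe, pow_one, ← huu, Units.inv_mul_cancel_right]
  let a : Bo ⟶ Bo := divRight ψ φ 1 (𝟙 Bo.base) 1 (pull B (inv (baseMap ψ)) (unit φ * ↑uu⁻¹)) e₁ e₂ e₃ e₄
  haveI : IsIso (baseMap a) := (inferInstance : IsIso (𝟙 Bo.base))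
  haveI : IsIso a := isIso_of hBg a rfl rfl
  exact ⟨asIso a, show _ ∧ _ from ⟨rfl, rfl⟩, comp_divRight ψ φ _ _ _ _ e₁ e₂ e₃ e₄⟩

/-- Def. 1.3 (vii)(a): the identity is an isotropic hull (every object is isotropic).
[cite: MochizukiFrdI2008, Thm. 5.2(ii) p.101] -/
theorem vii_a (hBg : Objectwise (fun M _ => IsGroupLike M) B) (A : ModelFrobenioid Φ B DivB) :
    ∃ (Bo : ModelFrobenioid Φ B DivB) (φ : A ⟶ Bo), PreFrobenioid.IsIsotropicHull (toElem Φ B DivB) φ :=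
  ⟨A, 𝟙 A, isIsometry_id A, isPreStep_id A, isIsotropic hBg A, fun _ γ _ =>
    ⟨γ, Category.id_comp γ, fun β hβ => (Category.id_comp β).symm.trans hβ⟩⟩

end Clauses

/-! ### Theorem 5.2 (ii), first sentence -/

/-- **FrdI Theorem 5.2 (ii), first sentence (Frobenioid part)**: for a divisorial monoid `Φ` and a
group-like monoid `B` on a connected, totally epimorphic category `D`, and a homomorphism
`Div_B : B → Φ^gp`, the model Frobenioid `C → F_Φ` of Thm. 5.2 (i) is a Frobenioid.
[cite: MochizukiFrdI2008, Thm. 5.2(ii) p.101] -/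
theorem isFrobenioid (hΦ : IsMonoidOn Φ) (hΦd : Objectwise (fun M _ => IsDivisorial M) Φ)
    (hB : IsMonoidOn B) (hBg : Objectwise (fun M _ => IsGroupLike M) B) (hDc : IsGraphConnected D)
    (hDe : IsTotallyEpimorphic D) : PreFrobenioid.IsFrobenioid (toElem Φ B DivB) where
  isPreFrobenioid := isPreFrobenioid hΦ hΦd hB hBg hDc hDe
  i_a := i_a hBg
  i_b := i_b
  i_c := i_c hΦd hBg
  ii_exists := ii_exists hBg
  ii_unique := fun _ _ _ φ ψ hφ hψ hn => ii_unique hBg φ ψ hφ hψ hn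
  iii_a := fun _ _ _ f g _ _ => isCoAngular hBg (f ≫ g)
  iii_b := fun _ _ _ _ ψ => isCoAngular hBg ψ
  iii_c := fun _ _ φ h => iii_c φ h
  iii_c_base := fun _ _ φ φ' h h' hb α β β' e₁ e₂ =>
    iii_c_base hΦ hΦd hB hBg φ φ' h h' hb α β β' e₁ e₂
  iii_d_under_full := fun _ _ _ φ φ' h h' hd => iii_d_under_full hBg φ φ' h h' hd
  iii_d_under_surj := iii_d_under_surj hBg
  iii_d_over_full := fun _ _ _ ψ ψ' h h' hd => iii_d_over_full hBg ψ ψ' h h' hd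
  iii_d_over_surj := iii_d_over_surj hBg
  iv_a_exists := fun _ _ φ => iv_a_exists hΦd hBg φ
  iv_a_unique := fun _ _ _ _ _ _ φ γ β α γ' β' α' h hγ hβ hα h' hγ' hβ' hα' =>
    iv_a_unique hΦ hΦd hB hBg hDe φ γ β α γ' β' α' h hγ hβ hα h' hγ' hβ' hα'
  iv_b := fun _ _ φ h => iv_b hΦd hBg φ h
  v_a := fun _ _ φ h => v_a hΦd hBg φ h
  v_b_exists := fun _ _ φ h => v_b_exists hBg φ h
  v_b_unique := fun _ _ _ _ φ β α β' α' e hβ hα e' hβ' hα' =>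
    v_b_unique hBg φ β α β' α' e hβ hα e' hβ' hα'
  v_c_exists := fun _ _ φ h => v_c_exists hBg φ h
  v_c_unique := fun _ _ _ _ φ β α β' α' e hβ hα e' hβ' hα' =>
    v_c_unique hBg φ β α β' α' e hβ hα e' hβ' hα'
  vi := fun _ _ φ ψ hφ hψ hb hm => vi hBg φ ψ hφ hψ hb hm
  vii_a := vii_a hBg
  vii_b := fun _ _ _ _ => isIsotropic hBg _

/-- **FrdI Theorem 5.2 (ii), first sentence (type part)**: the model Frobenioid is of isotropic
type. [cite: MochizukiFrdI2008, Thm. 5.2(ii) p.101] -/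
theorem isOfIsotropicType (hBg : Objectwise (fun M _ => IsGroupLike M) B) :
    PreFrobenioid.IsOfIsotropicType (toElem Φ B DivB) :=
  fun X => isIsotropic hBg X

end ModelFrobenioid

end Literature.AlgebraicGeometry.Frobenioids
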